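import Summits.QuantumAdvantage.QuantumAdvantage.Theorems.CubicForrelationNearExactIsExactRmWeight
import Summits.QuantumAdvantage.QuantumAdvantage.Theorems.CubicForrelationNearExactIsExactDerivDegree
import Summits.QuantumAdvantage.QuantumAdvantage.Theorems.CubicForrelationNearExactIsExactConcatAveraging

/-!
# `NearExactIsExact` (stmt-QuantumAdvantage-14043), negative side — the DEGREE OBSTRUCTION for
# dual-reading partners of Maiorana–McFarland slice families

B2b disprover cell, generation 31 (`b2b-cforr-disprove-g31`).  HONEST FRAMING: a small kernel-checked counting lemma
([folklore] ingredient: the Reed–Muller minimum distance `d(RM(3,s)) = 2^{s-3}`, here the landed `stub_rmWeight stub_derivDegree`);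
it is the load-bearing step of `DISPROOF.md` §39.7(iii) ("the field tower does not climb"); it is NOT summit progress and produces
no forrelation value.

**The mechanism it constrains.**  In a relabeled fibre family `G(x′,y,z) = x′·σ(y) ⊕ h_y(z)` (`x′, y ∈ 𝔽₂^s`) whose bent slices are
square Maiorana–McFarland functions `h_y(z′,z″) = z′·A_y z″ ⊕ c_y(z′)` with the matrix `A_y` AFFINE in `y`, the dual of a bent slice has
`c′ × c″` block `A_y^{-T}`.  A cubic partner `f` read through `f′ = f ⊕ b·u(a)` (`u = σ⁻¹`, of degree `≤ 2`, so that `a ↦ A_{u(a)}` has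
entries of degree `≤ 2`) has, in every fibre `b`, a `c′ × c″` block `Λ_b(a)` that is AFFINE in `a` (entries of degree `≤ 1`), and the
slice `u(a)` is matched exactly in fibre `b` only if `A_{u(a)}ᵀ Λ_b(a) = I`.  The entries of `a ↦ A_{u(a)}ᵀ Λ_b(a) ⊕ I` are Boolean
functions of degree `≤ 3` (`isDegLeFun_mulEntry`), so (`mulEntry_eq_all_or_card`): EITHER the identity holds for every `a` — then every
`A_y` is invertible, every slice is bent and `G` is bent (the bent branch, THEOREM BENT of the cell) — OR it fails on at least
`2^{s-3}` of the `2^s` slices (`two_pow_le_card_entry_ne`), each of which then contributes at most `3/4` of a matched bent slice,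
whence `Φ ≤ 31/32` for this mechanism AT EVERY FRAME SIZE `s` (`15/16` when the duals share the partner's cubic part; the `𝔽₈`
chain is the case `s = 3`, value `57/64`).  The modelling sentences of this paragraph are paper (§39.5, §39.7); this file certifies
only the counting dichotomy they rest on, in the tree's `Bool`/`IsDegLeFun` vocabulary.

References: F. J. MacWilliams, N. J. A. Sloane, The Theory of Error-Correcting Codes (1977) Ch. 13 Thm 3; C. Carlet, Boolean
Functions for Cryptography and Coding Theory (CUP 2021) §2.2, §6.1.15 (Maiorana–McFarland duals).  Everything below is proved;
standard axioms only.
-/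

set_option linter.dupNamespace false -- D-0017: single-problem summit ⇒ `QuantumAdvantage.QuantumAdvantage` by design

namespace Summit.QuantumAdvantage.QuantumAdvantage.Theorems.NearExactIsExact.Negative.DegreeObstruction

open Finset
open Literature.Computability.QuantumComplexity
open Summit.QuantumAdvantage.QuantumAdvantage.Theorems.CubicForrelation.NearExactIsExact
  (bb_deg_xor bb_deg_and stub_rmWeight stub_derivDegree)

variable {s r : ℕ}

/-- Degree `≤ d` is closed under finite `⊕`-sums (a right fold of `xor` over a list). -/
theorem isDegLeFun_foldr_xor {ι : Type*} {d : ℕ} (F : ι → (Fin s → Bool) → Bool) (l : List ι)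
    (hl : ∀ k ∈ l, IsDegLeFun d (F k)) :
    IsDegLeFun d (fun a => l.foldr (fun k acc => xor (F k a) acc) false) := by
  induction l with
  | nil => exact isDegLeFun_const d false
  | cons k l ih =>
    have hk : IsDegLeFun d (F k) := hl k List.mem_cons_self
    have ih' := ih fun k' hk' => hl k' (List.mem_cons_of_mem _ hk')
    exact bb_deg_xor hk ih'

/-- Entry `(i,j)` of the Boolean (`𝔽₂`) matrix product `A(a)·Λ(a)` — written as the `⊕`-fold
`⊕_k (A(a)_{ik} ∧ Λ(a)_{kj})` over `k ∈ Fin r` — has degree `≤ 3` in the parameter `a ∈ 𝔽₂^s` when the entries of `A(a)` have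
degree `≤ 2` and those of `Λ(a)` degree `≤ 1`. -/
theorem isDegLeFun_mulEntry (A Λ : (Fin s → Bool) → Fin r → Fin r → Bool)
    (hA : ∀ i k, IsDegLeFun 2 (fun a => A a i k)) (hΛ : ∀ k j, IsDegLeFun 1 (fun a => Λ a k j)) (i j : Fin r) :
    IsDegLeFun 3 (fun a => (List.finRange r).foldr (fun k acc => xor (A a i k && Λ a k j) acc) false) :=
  isDegLeFun_foldr_xor (fun k a => A a i k && Λ a k j) (List.finRange r)
    fun k _ => bb_deg_and (hA i k) (hΛ k j) (by norm_num)

/-- **Degree obstruction (counting form, per entry).**  If `A` has entries of degree `≤ 2`, `Λ` entries of degree `≤ 1`,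
and at some parameter `a₀` the entry `(i,j)` of `A(a₀)·Λ(a₀)` differs from that of the identity matrix, then it differs on at
least `2^{s-3}` parameters: `2^s ≤ 8 · #{a : (A(a)·Λ(a))_{ij} ≠ δ_{ij}}` — in particular `A(a)·Λ(a) ≠ I` for at least `2^{s-3}`
of the `2^s` parameters. -/
theorem two_pow_le_card_entry_ne (A Λ : (Fin s → Bool) → Fin r → Fin r → Bool)
    (hA : ∀ i k, IsDegLeFun 2 (fun a => A a i k)) (hΛ : ∀ k j, IsDegLeFun 1 (fun a => Λ a k j))
    {i j : Fin r} {a₀ : Fin s → Bool}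
    (hij : (List.finRange r).foldr (fun k acc => xor (A a₀ i k && Λ a₀ k j) acc) false ≠ decide (i = j)) :
    2 ^ s ≤ 2 ^ 3 * (univ.filter fun a =>
      (List.finRange r).foldr (fun k acc => xor (A a i k && Λ a k j) acc) false ≠ decide (i = j)).card := by
  classical
  let e : (Fin s → Bool) → Bool := fun a =>
    xor ((List.finRange r).foldr (fun k acc => xor (A a i k && Λ a k j) acc) false) (decide (i = j))
  have hdeg : IsDegLeFun 3 e := bb_deg_xor (isDegLeFun_mulEntry A Λ hA hΛ i j) (isDegLeFun_const 3 _)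
  have hxor : ∀ p q : Bool, xor p q = true ↔ p ≠ q := by decide
  have hex : ∃ a, e a = true := ⟨a₀, (hxor _ _).2 hij⟩
  refine (stub_rmWeight stub_derivDegree s 3 e hdeg hex).trans (Nat.mul_le_mul_left _ (card_le_card ?_))
  intro a ha
  simp only [mem_filter, mem_univ, true_and] at ha ⊢
  exact (hxor _ _).1 ha

/-- **Degree obstruction (dichotomy).**  Under the same degree hypotheses: EITHER `A(a)·Λ(a) = I` for every parameter `a`
(so every `A(a)` is invertible — in the application: every slice is bent and `G` is bent), OR some entry of `A(a)·Λ(a) ⊕ I`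
is non-zero on at least `2^{s-3}` of the `2^s` parameters (so at least `2^{s-3}` slices are unmatched). -/
theorem mulEntry_eq_all_or_card (A Λ : (Fin s → Bool) → Fin r → Fin r → Bool)
    (hA : ∀ i k, IsDegLeFun 2 (fun a => A a i k)) (hΛ : ∀ k j, IsDegLeFun 1 (fun a => Λ a k j)) :
    (∀ a (i j : Fin r), (List.finRange r).foldr (fun k acc => xor (A a i k && Λ a k j) acc) false = decide (i = j)) ∨
      ∃ i j : Fin r, 2 ^ s ≤ 2 ^ 3 * (univ.filter fun a =>
        (List.finRange r).foldr (fun k acc => xor (A a i k && Λ a k j) acc) false ≠ decide (i = j)).card := by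
  classical
  by_cases h : ∀ a (i j : Fin r),
      (List.finRange r).foldr (fun k acc => xor (A a i k && Λ a k j) acc) false = decide (i = j)
  · exact Or.inl h
  · obtain ⟨a₀, ha₀⟩ := not_forall.mp h
    obtain ⟨i, hi⟩ := not_forall.mp ha₀
    obtain ⟨j, hij⟩ := not_forall.mp hi
    exact Or.inr ⟨i, j, two_pow_le_card_entry_ne A Λ hA hΛ hij⟩

end Summit.QuantumAdvantage.QuantumAdvantage.Theorems.NearExactIsExact.Negative.DegreeObstruction
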